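import Literature.Geometry.Lorentzian.FinalState
import HarnessLib

/-!
# Quasi (`ε`-) final state decompositions: the orbital-stability form of `FinalStateDecomposition`

Trunk T-LORENTZ, family `gr`, topic `Literature/Geometry/Lorentzian`, next to `KerrConvergence`
(`FinalStateDecomposition`) and `FinalState` (`FinalStateDecomposition.charted/ofLE`).

Klainerman distinguishes two notions of stability of a stationary solution `φ₀` of a nonlinear
evolution equation: **orbital stability**, "according to which small perturbations of `φ₀` lead to
solutions `φ` which remain close to `φ₀` for all time, and asymptotic stability (AS) according to
which the perturbed solutions converge as `t → ∞` to `φ₀`" (Klainerman, C. R. Mécanique 353 (2025),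
§2.3, p. 559; Klainerman–Szeftel, AMS-210 (2020), §1.2, obstacle 1: "remain close, in some norm …
for all time" versus "converge, as `t → ∞`, to a nearby stationary solution"). The tree already has
both notions for ONE background (`Spacetime.RemainsCloseTo` / `Spacetime.ConvergesTo`,
`KerrConvergence`), and the asymptotic notion for the folklore `N`-black-hole final state
(`FinalStateDecomposition 𝓢 𝒟 k`: Klainerman 2025, §1.1.1, "solutions which behave, in the large,
like a finite number of Kerr black holes plus a radiative decaying term"). This file adds the
orbital (`ε`-quasi) form of the latter.

## Contents (namespace `Literature.Geometry.Lorentzian`)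

* `QuasiFinalStateDecomposition 𝓢 𝒟 k ε` — a structure with EXACTLY the data and clauses of
  `FinalStateDecomposition 𝓢 𝒟 k` (`N`, `mass`, `spin`, `mass_pos`, `abs_spin_le_mass`, `motion`,
  `τ₀`, `chart`, `isLateChart`, `exists_pairwise_disjoint`, `excision`, `tendsto_excision_div`,
  `flatDomain`, `setOf_lt_excision_subset_flatDomain`, `flatChart`, `isLateChart_flat`,
  `diff_subset_causalPast`, verbatim) except that the two convergence fields
  `tendsto_truncDeviationCk`, `tendsto_deviationCk_flat` (`Tendsto … atTop (𝓝 0)`) are replaced by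
  EVENTUAL `ε`-CLOSENESS in the same `Cᵏ` sup norms:
  `eventually_truncDeviationCk_le : ∀ i R, ∀ᶠ τ in atTop, truncDeviationCk … k R τ ≤ ε` and
  `eventually_deviationCk_flat_le : ∀ᶠ τ in atTop, deviationCk (flat) … k τ ≤ ε`.
* the same sanity API as for `FinalStateDecomposition`: `background`, `region`, `radiationZone`,
  `charted` (+ `_subset` lemmas), `lateRegion_subset_flatDomain_of_N_eq_zero`,
  `ofRemainsCloseToMinkowski`;
* `certifiedLate`, `certifiedSlab`, `HasExhaustiveCharts` — verbatim the bodies of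
  `Summit.FinalStateConjecture.certifiedLate/certifiedSlab/HasExhaustiveCharts`
  (`Summits/FinalStateConjecture/FinalStateConjecture/Statement.lean`, which Literature may not
  import), the growing-radii convergence clause of `HasExhaustiveCharts` becoming
  `∀ i, ∀ᶠ τ in atTop, truncDeviationCk … k (R i τ) τ ≤ ε`;
* `ofLE` (lowering `k`), `mono` (raising `ε`), and the forgetful map
  `FinalStateDecomposition.toQuasi : FinalStateDecomposition 𝓢 𝒟 k → 0 < ε →
  QuasiFinalStateDecomposition 𝓢 𝒟 k ε` (same charts; `charted`, `certifiedLate`, `certifiedSlab`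
  agree by `rfl`, and Summit-side exhaustiveness transfers: `hasExhaustiveCharts_toQuasi`);
* `limsup_truncDeviationCk_le`, `limsup_deviationCk_flat_le`: the `limsup ≤ ε` reading.

## Design choices

* **Eventual, not from `τ₀` on.** `RemainsCloseTo` asks `deviationCk ≤ ε` for all `τ ≥ τ₀`; here
  closeness is `∀ᶠ τ in atTop` while `τ₀` keeps its role in the chart/covering clauses. This is
  exactly what `Tendsto … (𝓝 0)` yields for `ε > 0` IN THE SAME CHART
  (`ConvergesTo.eventually_le`), so the forgetful map keeps every chart, `τ₀` and the covering
  clause verbatim (re-basing the covering clause `𝒟 ∖ charts ⊆ J⁻(slabs at τ₀)` to a later time is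
  a genuine causal-geometric statement, not bookkeeping). Eventual `≤ ε` implies `limsup ≤ ε`
  (`limsup_truncDeviationCk_le`) and is implied by `limsup < ε` (`Filter.eventually_lt_of_limsup_lt`),
  so the two typings of "`ε`-quasi" named by the requesting route agree up to `ε ↦ ε'` for any
  `ε' > ε`.
* **`ε : ℝ≥0∞`**, the codomain of `deviationCk` (as in `RemainsCloseTo`): `ε = ⊤` makes the two
  closeness clauses vacuous (what remains is the chart geometry: late charts, separation, sublinear
  excision, covering), `ε = 0` is eventual flatness/Kerrness of the pulled-back metric on the slabs.
  The forgetful map needs `0 < ε` (for `ε = 0` it is false: convergence does not give eventual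
  equality).
* **Anti-vacuity** is inherited from `FinalStateDecomposition`: `atTop` on `ℝ` is non-trivial, so
  `∀ᶠ` is not free; for `N = 0` the flat domain contains the whole late half-space
  (`lateRegion_subset_flatDomain_of_N_eq_zero`).

## What is NOT here

* The upgrade "an `ε`-quasi-decomposition of a vacuum MGHD (for `ε` small against the margins) is a
  true decomposition" (orbital ⇒ asymptotic stability of sub-extremal multi-Kerr) — an open
  problem, to be filed as a route item, never a Literature fact.
* The mass-normalised `(δ, ε)`-tube hypothesis inlined in route `PhotonSphereCapacity`
  (unit-mass Kerr charts, weights `Mᵢ²`) — a different notion; not this request.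
* No converse `N = 0 ⇒ RemainsCloseToMinkowski` (it would need the re-based covering clause).

## Mathlib

No Lorentzian geometry, Kerr family or stability notions in Mathlib (see `KerrConvergence`). Used:
`Filter.Eventually`, `Filter.Tendsto.eventually`, `ge_mem_nhds`, `Filter.limsup_le_of_le`,
`TopologicalSpace.Opens`, `Set` algebra.

## References

* S. Klainerman, *The black hole stability problem*, C. R. Mécanique 353 (2025) 555–581, §1.1.1
  (pp. 556–557, final state conjecture) and §2.3 (p. 559, notions of stability).
* S. Klainerman, J. Szeftel, *Global Nonlinear Stability of Schwarzschild Spacetime under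
  Polarized Perturbations*, Annals of Mathematics Studies 210, Princeton 2020, §1.2 (stability of
  Kerr conjecture; orbital versus asymptotic stability).
* M. Dafermos, G. Holzegel, I. Rodnianski, M. Taylor, arXiv:2104.08222, §1 ("remains close to").
-/

noncomputable section

open Set TopologicalSpace Filter Topology
open scoped Manifold ContDiff Topology ENNReal

universe u

namespace Literature.Geometry.Lorentzian

/-- **Hypothesis structure: `ε`-quasi `N`-black-hole final state decomposition** of the region
`𝒟 ⊆ 𝓢.carrier`, in `Cᵏ` — the ORBITAL-STABILITY form of `FinalStateDecomposition 𝓢 𝒟 k`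
(Klainerman 2025, §2.3: perturbations "remain close to `φ₀` for all time", as opposed to converging;
Klainerman–Szeftel, AMS-210, §1.2). Same data and clauses as `FinalStateDecomposition`: the number
`N` of holes; masses/spins with `0 < Mᵢ`, `|aᵢ| ≤ Mᵢ`; motions `(Λᵢ, cᵢ)`; a common late time `τ₀`;
late-time charts `chart i` on the boosted Kerr exteriors and a flat chart `flatChart` on
`flatDomain ⊆ E4` (all `IsLateChart` into `𝒟` after `τ₀`); separation of the holes; sublinear
excision radii with the flat domain containing the late half-space minus the excised tubes; the
global covering clause — but instead of `Cᵏ` CONVERGENCE to boosted Kerr on the truncated slabs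
`{t*ᵢ = τ, rᵢ ≤ R}` and to `η` on the flat slabs `{x⁰ = τ}`, only EVENTUAL `ε`-CLOSENESS:
`truncDeviationCk … k R τ ≤ ε` and `deviationCk (flat) … k τ ≤ ε` for all large `τ`
(`ε : ℝ≥0∞`; `ε = ⊤` vacuous closeness, `ε = 0` eventual exactness). Every
`FinalStateDecomposition` is an `ε`-quasi one for every `ε > 0` with the same charts
(`FinalStateDecomposition.toQuasi`). The final state picture itself is Klainerman 2025, §1.1.1
("a finite number of Kerr black holes plus a radiative decaying term"); no printed `N ≥ 2`
formulation exists (see `FinalStateDecomposition`). [cite: Klainerman2025, §2.3 (p. 559) and §1.1.1] -/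
structure QuasiFinalStateDecomposition (𝓢 : Spacetime.{u} 4) (𝒟 : Set 𝓢.carrier) (k : ℕ)
    (ε : ℝ≥0∞) where
  /-- The number of (quasi-)final black holes. -/
  N : ℕ
  /-- The masses `Mᵢ` of the reference Kerr exteriors. -/
  mass : Fin N → ℝ
  /-- The specific angular momenta `aᵢ` of the reference Kerr exteriors. -/
  spin : Fin N → ℝ
  /-- Each mass is positive, `0 < Mᵢ`. -/
  mass_pos : ∀ i, 0 < mass i
  /-- Each reference black hole is Kerr with `|aᵢ| ≤ Mᵢ` (extremality not excluded). -/
  abs_spin_le_mass : ∀ i, |spin i| ≤ mass i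
  /-- The motion `(Λᵢ, cᵢ)` (boost/rotation and translation) of black hole `i`. -/
  motion : Fin N → lorentzGroup × E4
  /-- The common initial late time `τ₀` of all charts. -/
  τ₀ : ℝ
  /-- The late-time chart of black hole `i`, on the boosted Kerr exterior
  `boostedKerrExterior Λᵢ cᵢ Mᵢ aᵢ`. -/
  chart : ∀ i, boostedKerrExterior (motion i).1 (motion i).2 (mass i) (spin i) → 𝓢.carrier
  /-- Each `chart i` is a late-time chart into `𝒟` after `τ₀`. -/
  isLateChart : ∀ i, 𝓢.IsLateChart
    (boostedKerrBackground (motion i).1 (motion i).2 (mass i) (spin i)) 𝒟 τ₀ (chart i)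
  /-- Near-zone `ε`-closeness: for every `R`, the `Cᵏ` deviation of `(chart i)^* g` from boosted
  Kerr `(Mᵢ, aᵢ, Λᵢ, cᵢ)` on the truncated slabs `{t*ᵢ = τ, rᵢ ≤ R}` is eventually `≤ ε`. -/
  eventually_truncDeviationCk_le : ∀ i (R : ℝ), ∀ᶠ τ in atTop, 𝓢.truncDeviationCk
    (boostedKerrBackground (motion i).1 (motion i).2 (mass i) (spin i)) (chart i) k R τ ≤ ε
  /-- The holes separate: for every `R` there is `τ₁` after which the truncated world-tubes
  `chart i '' {t*ᵢ > τ₁, rᵢ ≤ R}` are pairwise disjoint. -/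
  exists_pairwise_disjoint : ∀ R : ℝ, ∃ τ₁ : ℝ, Pairwise (Function.onFun Disjoint fun i ↦
    chart i '' (boostedKerrBackground (motion i).1 (motion i).2 (mass i) (spin i)
      |>.truncLateRegion τ₁ R))
  /-- The excision radius `ρᵢ(t)` of the near-zone tube of hole `i` at flat time `t`. -/
  excision : Fin N → ℝ → ℝ
  /-- The excision radii grow sublinearly, `ρᵢ(t) / t → 0`. -/
  tendsto_excision_div : ∀ i, Tendsto (fun t ↦ excision i t / t) atTop (𝓝 0)
  /-- The coordinate domain `U₀ ⊆ E4` of the flat (radiation-zone) chart. -/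
  flatDomain : Opens E4
  /-- The flat domain contains the late half-space `{x⁰ > τ₀}` minus the excised tubes
  `{rᵢ(Λᵢ⁻¹(x − cᵢ)) ≤ ρᵢ(x⁰)}` around the holes' straight world-lines. -/
  setOf_lt_excision_subset_flatDomain :
    {x : E4 | τ₀ < x 0 ∧ ∀ i, excision i (x 0) <
      Kerr.radius (spin i) (poincareInv (motion i).1 (motion i).2 x)} ⊆ flatDomain
  /-- The flat (radiation-zone) chart. -/
  flatChart : flatDomain → 𝓢.carrier
  /-- The flat chart is a late-time chart into `𝒟` after `τ₀` (Minkowski background on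
  `flatDomain`, time `x⁰`). -/
  isLateChart_flat : 𝓢.IsLateChart (Minkowski.backgroundOn flatDomain) 𝒟 τ₀ flatChart
  /-- Radiation-zone `ε`-closeness: the full `Cᵏ` deviation of `flatChart^* g` from `η` on the
  slabs `{x⁰ = τ} ∩ U₀` is eventually `≤ ε`. -/
  eventually_deviationCk_flat_le :
    ∀ᶠ τ in atTop, 𝓢.deviationCk (Minkowski.backgroundOn flatDomain) flatChart k τ ≤ ε
  /-- Global covering clause: the part of `𝒟` not covered by the late images of the `N + 1`
  charts lies in the causal past of the images of their initial slabs `{t = τ₀}`. -/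
  diff_subset_causalPast :
    𝒟 \ ((⋃ i, chart i '' (boostedKerrBackground (motion i).1 (motion i).2 (mass i)
        (spin i)).lateRegion τ₀) ∪
        flatChart '' (Minkowski.backgroundOn flatDomain).lateRegion τ₀) ⊆
      𝓢.metric.causalPast 𝓢.timeOrientation
        ((⋃ i, chart i '' (boostedKerrBackground (motion i).1 (motion i).2 (mass i)
          (spin i)).timeSlab τ₀) ∪
          flatChart '' (Minkowski.backgroundOn flatDomain).timeSlab τ₀)

namespace QuasiFinalStateDecomposition

variable {𝓢 : Spacetime.{u} 4} {𝒟 : Set 𝓢.carrier} {k : ℕ} {ε : ℝ≥0∞}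

/-- The reference background of black hole `i` (boosted Kerr `(Mᵢ, aᵢ)` with motion `(Λᵢ, cᵢ)`),
as for `FinalStateDecomposition.background`. Klainerman 2025, §1.1.1. [cite: Klainerman2025, §1.1.1] -/
def background (d : QuasiFinalStateDecomposition 𝓢 𝒟 k ε) (i : Fin d.N) : ModelBackground :=
  boostedKerrBackground (d.motion i).1 (d.motion i).2 (d.mass i) (d.spin i)

/-- The **black-hole region** of hole `i`: the image of the late boosted Kerr exterior
`{t*ᵢ > τ₀}` under `chart i`. Klainerman 2025, §1.1.1. [cite: Klainerman2025, §1.1.1] -/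
def region (d : QuasiFinalStateDecomposition 𝓢 𝒟 k ε) (i : Fin d.N) : Set 𝓢.carrier :=
  d.chart i '' (d.background i).lateRegion d.τ₀

/-- The **radiation zone**: the image of the late flat domain `{x⁰ > τ₀} ∩ U₀` under the flat
chart. Klainerman 2025, §1.1.1 ("a radiative decaying term"). [cite: Klainerman2025, §1.1.1] -/
def radiationZone (d : QuasiFinalStateDecomposition 𝓢 𝒟 k ε) : Set 𝓢.carrier :=
  d.flatChart '' (Minkowski.backgroundOn d.flatDomain).lateRegion d.τ₀

/-- Each black-hole region lies in `𝒟`. [folklore] -/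
theorem region_subset (d : QuasiFinalStateDecomposition 𝓢 𝒟 k ε) (i : Fin d.N) :
    d.region i ⊆ 𝒟 :=
  (d.isLateChart i).image_subset

/-- The radiation zone lies in `𝒟`. [folklore] -/
theorem radiationZone_subset (d : QuasiFinalStateDecomposition 𝓢 𝒟 k ε) :
    d.radiationZone ⊆ 𝒟 :=
  d.isLateChart_flat.image_subset

/-- The **charted late region**: radiation zone plus the `N` black-hole regions (verbatim
`FinalStateDecomposition.charted`). Klainerman 2025, §1.1.1. [cite: Klainerman2025, §1.1.1] -/
def charted (d : QuasiFinalStateDecomposition 𝓢 𝒟 k ε) : Set 𝓢.carrier :=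
  d.radiationZone ∪ ⋃ i, d.region i

/-- The charted late region lies in `𝒟`. [folklore] -/
theorem charted_subset (d : QuasiFinalStateDecomposition 𝓢 𝒟 k ε) : d.charted ⊆ 𝒟 :=
  union_subset d.radiationZone_subset (iUnion_subset d.region_subset)

/-- The radiation zone is part of the charted late region. [folklore] -/
theorem radiationZone_subset_charted (d : QuasiFinalStateDecomposition 𝓢 𝒟 k ε) :
    d.radiationZone ⊆ d.charted :=
  subset_union_left

/-- Each black-hole region is part of the charted late region. [folklore] -/
theorem region_subset_charted (d : QuasiFinalStateDecomposition 𝓢 𝒟 k ε) (i : Fin d.N) :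
    d.region i ⊆ d.charted :=
  (subset_iUnion (fun i ↦ d.region i) i).trans subset_union_right

/-- The `limsup` reading of near-zone `ε`-closeness: `limsup_{τ → ∞} ‖(chart i)^* g − g_{Kerr}‖_{Cᵏ
({t*ᵢ = τ, rᵢ ≤ R})} ≤ ε` (Klainerman 2025, §2.3, orbital stability). [cite: Klainerman2025, §2.3] -/
theorem limsup_truncDeviationCk_le (d : QuasiFinalStateDecomposition 𝓢 𝒟 k ε) (i : Fin d.N)
    (R : ℝ) :
    limsup (fun τ ↦ 𝓢.truncDeviationCk (d.background i) (d.chart i) k R τ) atTop ≤ ε :=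
  Filter.limsup_le_of_le (h := d.eventually_truncDeviationCk_le i R)

/-- The `limsup` reading of radiation-zone `ε`-closeness: `limsup_{τ → ∞} ‖flatChart^* g − η‖_{Cᵏ
({x⁰ = τ})} ≤ ε` (Klainerman 2025, §2.3, orbital stability). [cite: Klainerman2025, §2.3] -/
theorem limsup_deviationCk_flat_le (d : QuasiFinalStateDecomposition 𝓢 𝒟 k ε) :
    limsup (fun τ ↦ 𝓢.deviationCk (Minkowski.backgroundOn d.flatDomain) d.flatChart k τ)
      atTop ≤ ε :=
  Filter.limsup_le_of_le (h := d.eventually_deviationCk_flat_le)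

/-! ### Certified regions and exhaustiveness (verbatim `Summit.FinalStateConjecture.…`) -/

/-- The **certified late region after chart time `τ₁`** with near-zone radii `R`: the flat
chart's image of `{x⁰ > τ₁}` together with each hole chart's image of its growing near zone
`{t*ᵢ > τ₁, rᵢ ≤ Rᵢ(t*ᵢ)}` — verbatim the body of `Summit.FinalStateConjecture.certifiedLate`.
Dafermos–Luk arXiv:1710.01722, Conjecture 1 (b) (the exterior region on which closeness to Kerr is
asserted). [folklore] -/
def certifiedLate (d : QuasiFinalStateDecomposition 𝓢 𝒟 k ε) (R : Fin d.N → ℝ → ℝ) (τ₁ : ℝ) :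
    Set 𝓢.carrier :=
  d.flatChart '' (Minkowski.backgroundOn d.flatDomain).lateRegion τ₁ ∪
    ⋃ i, d.chart i '' {x | τ₁ < (d.background i).time x.1 ∧
      (d.background i).radius x.1 ≤ R i ((d.background i).time x.1)}

/-- The **certified slab at chart time `τ₁`**: the flat chart's image of `{x⁰ = τ₁} ∩ U₀`
together with each hole chart's image of `{t*ᵢ = τ₁, rᵢ ≤ Rᵢ(τ₁)}` — verbatim the body of
`Summit.FinalStateConjecture.certifiedSlab`. [folklore] -/
def certifiedSlab (d : QuasiFinalStateDecomposition 𝓢 𝒟 k ε) (R : Fin d.N → ℝ → ℝ) (τ₁ : ℝ) :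
    Set 𝓢.carrier :=
  d.flatChart '' (Minkowski.backgroundOn d.flatDomain).timeSlab τ₁ ∪
    ⋃ i, d.chart i '' (d.background i).truncTimeSlab (R i τ₁) τ₁

/-- After `τ₀`, the certified late region is part of the charted late region. [folklore] -/
theorem certifiedLate_subset_charted (d : QuasiFinalStateDecomposition 𝓢 𝒟 k ε)
    (R : Fin d.N → ℝ → ℝ) {τ₁ : ℝ} (h : d.τ₀ ≤ τ₁) : d.certifiedLate R τ₁ ⊆ d.charted := by
  refine union_subset_union (image_mono ((Minkowski.backgroundOn d.flatDomain).lateRegion_mono h))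
    (iUnion_mono fun i ↦ image_mono fun x hx ↦ ?_)
  exact (ModelBackground.mem_lateRegion).2 (lt_of_le_of_lt h hx.1)

/-- The certified slab at a chart time `τ₁ > τ₀` is part of the charted late region. [folklore] -/
theorem certifiedSlab_subset_charted (d : QuasiFinalStateDecomposition 𝓢 𝒟 k ε)
    (R : Fin d.N → ℝ → ℝ) {τ₁ : ℝ} (h : d.τ₀ < τ₁) : d.certifiedSlab R τ₁ ⊆ d.charted :=
  union_subset_union
    (image_mono ((Minkowski.backgroundOn d.flatDomain).timeSlab_subset_lateRegion h))
    (iUnion_mono fun i ↦ image_mono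
      (((d.background i).truncTimeSlab_subset_timeSlab _ _).trans
        ((d.background i).timeSlab_subset_lateRegion h)))

/-- **The charts exhaust the region, `ε`-quasi form** — verbatim
`Summit.FinalStateConjecture.HasExhaustiveCharts` with the growing-radii convergence clause replaced
by eventual `ε`-closeness: there are near-zone radii `Rᵢ : ℝ → ℝ` such that (i) the `Cᵏ` deviation
of `(chart i)^* g` from boosted Kerr on the truncated slabs `{t*ᵢ = τ, rᵢ ≤ Rᵢ(τ)}` is eventually
`≤ ε`, and (ii) for EVERY chart time `τ₁ > τ₀`, every point of `𝒟` outside the certified late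
region after `τ₁` lies in the causal past of the certified slab at `τ₁`. Dafermos–Luk
arXiv:1710.01722, Conjecture 1 (b) ("the geometry remains close to `g_{a₀,M₀}` in `J⁻(𝓘⁺)`").
[folklore] -/
def HasExhaustiveCharts (d : QuasiFinalStateDecomposition 𝓢 𝒟 k ε) : Prop :=
  ∃ R : Fin d.N → ℝ → ℝ,
    (∀ i, ∀ᶠ τ in atTop, 𝓢.truncDeviationCk (d.background i) (d.chart i) k (R i τ) τ ≤ ε) ∧
    ∀ τ₁ : ℝ, d.τ₀ < τ₁ →
      𝒟 \ d.certifiedLate R τ₁ ⊆ 𝓢.metric.causalPast 𝓢.timeOrientation (d.certifiedSlab R τ₁)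

/-! ### Monotonicity in `k` and in `ε` -/

/-- An `ε`-quasi decomposition in `Cᵏ'` is one in `Cᵏ` for `k ≤ k'`, **with the same charts**
(all `Cᵏ` sup norms are monotone in `k`, `supCkENorm_mono_right`); cf.
`FinalStateDecomposition.ofLE`. DHRT arXiv:2104.08222, §1. [folklore] -/
def ofLE {k k' : ℕ} (d : QuasiFinalStateDecomposition 𝓢 𝒟 k' ε) (h : k ≤ k') :
    QuasiFinalStateDecomposition 𝓢 𝒟 k ε where
  N := d.N
  mass := d.mass
  spin := d.spin
  mass_pos := d.mass_pos
  abs_spin_le_mass := d.abs_spin_le_mass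
  motion := d.motion
  τ₀ := d.τ₀
  chart := d.chart
  isLateChart := d.isLateChart
  eventually_truncDeviationCk_le i R :=
    (d.eventually_truncDeviationCk_le i R).mono fun _ hτ ↦ (supCkENorm_mono_right _ h _).trans hτ
  exists_pairwise_disjoint := d.exists_pairwise_disjoint
  excision := d.excision
  tendsto_excision_div := d.tendsto_excision_div
  flatDomain := d.flatDomain
  setOf_lt_excision_subset_flatDomain := d.setOf_lt_excision_subset_flatDomain
  flatChart := d.flatChart
  isLateChart_flat := d.isLateChart_flat
  eventually_deviationCk_flat_le :=
    d.eventually_deviationCk_flat_le.mono fun _ hτ ↦ (supCkENorm_mono_right _ h _).trans hτ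
  diff_subset_causalPast := d.diff_subset_causalPast

/-- Lowering `k` does not change the charted late region. [folklore] -/
@[simp]
theorem charted_ofLE {k k' : ℕ} (d : QuasiFinalStateDecomposition 𝓢 𝒟 k' ε) (h : k ≤ k') :
    (d.ofLE h).charted = d.charted :=
  rfl

/-- Lowering `k` does not change the certified late regions. [folklore] -/
@[simp]
theorem certifiedLate_ofLE {k k' : ℕ} (d : QuasiFinalStateDecomposition 𝓢 𝒟 k' ε) (h : k ≤ k')
    (R : Fin d.N → ℝ → ℝ) (τ₁ : ℝ) : (d.ofLE h).certifiedLate R τ₁ = d.certifiedLate R τ₁ :=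
  rfl

/-- Lowering `k` does not change the certified slabs. [folklore] -/
@[simp]
theorem certifiedSlab_ofLE {k k' : ℕ} (d : QuasiFinalStateDecomposition 𝓢 𝒟 k' ε) (h : k ≤ k')
    (R : Fin d.N → ℝ → ℝ) (τ₁ : ℝ) : (d.ofLE h).certifiedSlab R τ₁ = d.certifiedSlab R τ₁ :=
  rfl

/-- Exhaustiveness survives lowering `k` (same radii). [folklore] -/
theorem HasExhaustiveCharts.ofLE {k k' : ℕ} {d : QuasiFinalStateDecomposition 𝓢 𝒟 k' ε}
    (hd : d.HasExhaustiveCharts) (h : k ≤ k') : (d.ofLE h).HasExhaustiveCharts := by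
  obtain ⟨R, hR, hcov⟩ := hd
  exact ⟨R, fun i ↦ (hR i).mono fun _ hτ ↦ (supCkENorm_mono_right _ h _).trans hτ, hcov⟩

/-- `ε`-closeness is monotone in `ε`: an `ε`-quasi decomposition is an `ε'`-quasi one for
`ε ≤ ε'`, with the same charts (cf. `RemainsCloseTo.mono`). Klainerman 2025, §2.3. [folklore] -/
def mono {ε ε' : ℝ≥0∞} (d : QuasiFinalStateDecomposition 𝓢 𝒟 k ε) (h : ε ≤ ε') :
    QuasiFinalStateDecomposition 𝓢 𝒟 k ε' where
  N := d.N
  mass := d.mass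
  spin := d.spin
  mass_pos := d.mass_pos
  abs_spin_le_mass := d.abs_spin_le_mass
  motion := d.motion
  τ₀ := d.τ₀
  chart := d.chart
  isLateChart := d.isLateChart
  eventually_truncDeviationCk_le i R :=
    (d.eventually_truncDeviationCk_le i R).mono fun _ hτ ↦ hτ.trans h
  exists_pairwise_disjoint := d.exists_pairwise_disjoint
  excision := d.excision
  tendsto_excision_div := d.tendsto_excision_div
  flatDomain := d.flatDomain
  setOf_lt_excision_subset_flatDomain := d.setOf_lt_excision_subset_flatDomain
  flatChart := d.flatChart
  isLateChart_flat := d.isLateChart_flat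
  eventually_deviationCk_flat_le := d.eventually_deviationCk_flat_le.mono fun _ hτ ↦ hτ.trans h
  diff_subset_causalPast := d.diff_subset_causalPast

/-- Raising `ε` does not change the charted late region. [folklore] -/
@[simp]
theorem charted_mono {ε ε' : ℝ≥0∞} (d : QuasiFinalStateDecomposition 𝓢 𝒟 k ε) (h : ε ≤ ε') :
    (d.mono h).charted = d.charted :=
  rfl

/-- Raising `ε` does not change the certified late regions. [folklore] -/
@[simp]
theorem certifiedLate_mono {ε ε' : ℝ≥0∞} (d : QuasiFinalStateDecomposition 𝓢 𝒟 k ε) (h : ε ≤ ε')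
    (R : Fin d.N → ℝ → ℝ) (τ₁ : ℝ) : (d.mono h).certifiedLate R τ₁ = d.certifiedLate R τ₁ :=
  rfl

/-- Raising `ε` does not change the certified slabs. [folklore] -/
@[simp]
theorem certifiedSlab_mono {ε ε' : ℝ≥0∞} (d : QuasiFinalStateDecomposition 𝓢 𝒟 k ε) (h : ε ≤ ε')
    (R : Fin d.N → ℝ → ℝ) (τ₁ : ℝ) : (d.mono h).certifiedSlab R τ₁ = d.certifiedSlab R τ₁ :=
  rfl

/-- Exhaustiveness survives raising `ε` (same radii). [folklore] -/
theorem HasExhaustiveCharts.mono {ε ε' : ℝ≥0∞} {d : QuasiFinalStateDecomposition 𝓢 𝒟 k ε}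
    (hd : d.HasExhaustiveCharts) (h : ε ≤ ε') : (d.mono h).HasExhaustiveCharts := by
  obtain ⟨R, hR, hcov⟩ := hd
  exact ⟨R, fun i ↦ (hR i).mono fun _ hτ ↦ hτ.trans h, hcov⟩

/-! ### Sanity: `N = 0` -/

/-- Anti-vacuity (`N = 0`): with no black hole the flat domain contains the whole late half-space
`{x⁰ > τ₀}` (as for `FinalStateDecomposition.lateRegion_subset_flatDomain_of_N_eq_zero`).
Christodoulou–Klainerman 1993, Thm. 1.0.2. [folklore] -/
theorem lateRegion_subset_flatDomain_of_N_eq_zero (d : QuasiFinalStateDecomposition 𝓢 𝒟 k ε)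
    (hN : d.N = 0) : Minkowski.lateRegion d.τ₀ ⊆ (d.flatDomain : Set E4) := fun _ hx ↦
  d.setOf_lt_excision_subset_flatDomain ⟨hx, fun i ↦ (hN ▸ i).elim0⟩

/-- Sanity (`N = 0`): `ε`-closeness to Minkowski space in `𝒟` (`RemainsCloseToMinkowski`, closeness
from `τ₀` on, flat chart on all of `E4`) gives an `ε`-quasi decomposition with no black hole
(cf. `FinalStateDecomposition.ofConvergesToMinkowski`). Uses choice to extract the chart.
DHRT arXiv:2104.08222, §1 ("remains close to"). [folklore] -/
def ofRemainsCloseToMinkowski (h : 𝓢.RemainsCloseToMinkowski 𝒟 k ε) :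
    QuasiFinalStateDecomposition 𝓢 𝒟 k ε where
  N := 0
  mass := Fin.elim0
  spin := Fin.elim0
  mass_pos i := i.elim0
  abs_spin_le_mass i := i.elim0
  motion := Fin.elim0
  τ₀ := h.choose
  chart i := i.elim0
  isLateChart i := i.elim0
  eventually_truncDeviationCk_le i := i.elim0
  exists_pairwise_disjoint _ := ⟨0, fun i ↦ i.elim0⟩
  excision := Fin.elim0
  tendsto_excision_div i := i.elim0
  flatDomain := ⊤
  setOf_lt_excision_subset_flatDomain _ _ := trivial
  flatChart := h.choose_spec.choose
  isLateChart_flat := h.choose_spec.choose_spec.1.toIsLateChart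
  eventually_deviationCk_flat_le :=
    eventually_atTop.2 ⟨h.choose, fun τ hτ ↦ h.choose_spec.choose_spec.2 τ hτ⟩
  diff_subset_causalPast := by
    rw [iUnion_of_empty, empty_union, iUnion_of_empty, empty_union]
    exact h.choose_spec.choose_spec.1.diff_subset_causalPast

/-- `ofRemainsCloseToMinkowski` has no black hole. [folklore] -/
@[simp]
theorem ofRemainsCloseToMinkowski_N (h : 𝓢.RemainsCloseToMinkowski 𝒟 k ε) :
    (ofRemainsCloseToMinkowski h).N = 0 :=
  rfl

end QuasiFinalStateDecomposition

/-! ### The forgetful map: asymptotic ⇒ orbital -/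

namespace FinalStateDecomposition

variable {𝓢 : Spacetime.{u} 4} {𝒟 : Set 𝓢.carrier} {k : ℕ} {ε : ℝ≥0∞}

/-- **Asymptotic stability implies orbital stability, with the same charts**: a final state
decomposition is an `ε`-quasi final state decomposition for every `ε > 0` (`Tendsto … (𝓝 0)` gives
`∀ᶠ τ, … ≤ ε`, `Filter.Tendsto.eventually` with `ge_mem_nhds`; all other fields verbatim). False for
`ε = 0`, whence the hypothesis. Klainerman 2025, §2.3 ("the second notion is far stronger");
Klainerman–Szeftel, AMS-210, §1.2. [cite: KlainermanSzeftel2020, §1.2] -/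
def toQuasi (d : FinalStateDecomposition 𝓢 𝒟 k) (hε : 0 < ε) :
    QuasiFinalStateDecomposition 𝓢 𝒟 k ε where
  N := d.N
  mass := d.mass
  spin := d.spin
  mass_pos := d.mass_pos
  abs_spin_le_mass := d.abs_spin_le_mass
  motion := d.motion
  τ₀ := d.τ₀
  chart := d.chart
  isLateChart := d.isLateChart
  eventually_truncDeviationCk_le i R := (d.tendsto_truncDeviationCk i R).eventually (ge_mem_nhds hε)
  exists_pairwise_disjoint := d.exists_pairwise_disjoint
  excision := d.excision
  tendsto_excision_div := d.tendsto_excision_div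
  flatDomain := d.flatDomain
  setOf_lt_excision_subset_flatDomain := d.setOf_lt_excision_subset_flatDomain
  flatChart := d.flatChart
  isLateChart_flat := d.isLateChart_flat
  eventually_deviationCk_flat_le := d.tendsto_deviationCk_flat.eventually (ge_mem_nhds hε)
  diff_subset_causalPast := d.diff_subset_causalPast

/-- The forgetful map keeps the number of holes. [folklore] -/
@[simp]
theorem toQuasi_N (d : FinalStateDecomposition 𝓢 𝒟 k) (hε : 0 < ε) : (d.toQuasi hε).N = d.N :=
  rfl

/-- The forgetful map keeps the common late time `τ₀`. [folklore] -/
@[simp]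
theorem toQuasi_τ₀ (d : FinalStateDecomposition 𝓢 𝒟 k) (hε : 0 < ε) : (d.toQuasi hε).τ₀ = d.τ₀ :=
  rfl

/-- The forgetful map keeps the hole backgrounds. [folklore] -/
@[simp]
theorem toQuasi_background (d : FinalStateDecomposition 𝓢 𝒟 k) (hε : 0 < ε) (i : Fin d.N) :
    (d.toQuasi hε).background i = d.background i :=
  rfl

/-- The forgetful map keeps the charted late region. [folklore] -/
@[simp]
theorem toQuasi_charted (d : FinalStateDecomposition 𝓢 𝒟 k) (hε : 0 < ε) :
    (d.toQuasi hε).charted = d.charted :=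
  rfl

/-- Unfolding: the certified late region of `d.toQuasi hε` is, verbatim, the body of
`Summit.FinalStateConjecture.certifiedLate d R τ₁` (so the two agree by `rfl`). [folklore] -/
theorem toQuasi_certifiedLate (d : FinalStateDecomposition 𝓢 𝒟 k) (hε : 0 < ε)
    (R : Fin d.N → ℝ → ℝ) (τ₁ : ℝ) :
    (d.toQuasi hε).certifiedLate R τ₁ =
      d.flatChart '' (Minkowski.backgroundOn d.flatDomain).lateRegion τ₁ ∪
        ⋃ i, d.chart i '' {x | τ₁ < (d.background i).time x.1 ∧
          (d.background i).radius x.1 ≤ R i ((d.background i).time x.1)} :=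
  rfl

/-- Unfolding: the certified slab of `d.toQuasi hε` is, verbatim, the body of
`Summit.FinalStateConjecture.certifiedSlab d R τ₁`. [folklore] -/
theorem toQuasi_certifiedSlab (d : FinalStateDecomposition 𝓢 𝒟 k) (hε : 0 < ε)
    (R : Fin d.N → ℝ → ℝ) (τ₁ : ℝ) :
    (d.toQuasi hε).certifiedSlab R τ₁ =
      d.flatChart '' (Minkowski.backgroundOn d.flatDomain).timeSlab τ₁ ∪
        ⋃ i, d.chart i '' (d.background i).truncTimeSlab (R i τ₁) τ₁ :=
  rfl

/-- **Summit-side exhaustiveness transfers along the forgetful map**: the hypothesis is, verbatim,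
the body of `Summit.FinalStateConjecture.HasExhaustiveCharts d` (growing radii `Rᵢ` with `Cᵏ`
convergence out to `Rᵢ(τ)` and the covering of `𝒟` by certified regions for every `τ₁ > τ₀`), the
conclusion the `ε`-quasi exhaustiveness of `d.toQuasi hε` with the same radii. [folklore] -/
theorem hasExhaustiveCharts_toQuasi (d : FinalStateDecomposition 𝓢 𝒟 k) (hε : 0 < ε)
    (h : ∃ R : Fin d.N → ℝ → ℝ,
      (∀ i, Tendsto (fun τ ↦ 𝓢.truncDeviationCk (d.background i) (d.chart i) k (R i τ) τ)
        atTop (𝓝 0)) ∧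
      ∀ τ₁ : ℝ, d.τ₀ < τ₁ →
        𝒟 \ (d.flatChart '' (Minkowski.backgroundOn d.flatDomain).lateRegion τ₁ ∪
            ⋃ i, d.chart i '' {x | τ₁ < (d.background i).time x.1 ∧
              (d.background i).radius x.1 ≤ R i ((d.background i).time x.1)}) ⊆
          𝓢.metric.causalPast 𝓢.timeOrientation
            (d.flatChart '' (Minkowski.backgroundOn d.flatDomain).timeSlab τ₁ ∪
              ⋃ i, d.chart i '' (d.background i).truncTimeSlab (R i τ₁) τ₁)) :
    (d.toQuasi hε).HasExhaustiveCharts := by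
  obtain ⟨R, hR, hcov⟩ := h
  exact ⟨R, fun i ↦ (hR i).eventually (ge_mem_nhds hε), hcov⟩

end FinalStateDecomposition

end Literature.Geometry.Lorentzian

end

/-! ## The converse of the forgetful map for ONE chart system

Orbital closeness IN FIXED CHARTS for every `δ > 0` is asymptotic closeness: if the charts of ONE
quasi decomposition `q` satisfy the two convergence clauses of `FinalStateDecomposition` (equivalently,
by `ENNReal.tendsto_nhds_zero`, eventual `δ`-closeness in the SAME charts for every `δ > 0`), then `q`
with the same data is a final state decomposition (`QuasiFinalStateDecomposition.toFinalStateDecomposition`),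
the two maps are mutually inverse (`toQuasi_toFinalStateDecomposition`,
`FinalStateDecomposition.toFinalStateDecomposition_toQuasi`, both `rfl`), and Summit-side exhaustiveness
of the result is, verbatim, the asymptotic exhaustiveness clause `HasAsymptoticallyExhaustiveCharts` of
`q` (`hasExhaustiveCharts_toFinalStateDecomposition`). Pure bookkeeping (Klainerman 2025, §2.3;
Klainerman–Szeftel, AMS-210, §1.2: the two notions differ only in `∀ δ` versus `→ 0` once the gauge is
fixed). NOT here, and not bookkeeping: the upgrade from a family of `δ`-quasi decompositions with
UNRELATED charts (one for each `δ > 0`) to one final state decomposition — it needs approximate-isometry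
rigidity of near-Kerr charts, chart patching in time and a re-derivation of the covering clauses. -/

noncomputable section

namespace Literature.Geometry.Lorentzian

open Set TopologicalSpace Filter Topology
open scoped Manifold ContDiff Topology ENNReal

universe u

namespace QuasiFinalStateDecomposition

variable {𝓢 : Spacetime.{u} 4} {𝒟 : Set 𝓢.carrier} {k : ℕ} {ε : ℝ≥0∞}

/-- **Orbital closeness in fixed charts for every `δ > 0` is asymptotic closeness** — the converse of
`FinalStateDecomposition.toQuasi` for ONE chart system: an `ε`-quasi decomposition whose own charts
satisfy the two convergence clauses (`Tendsto … atTop (𝓝 0)` of the truncated near-zone deviations for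
every `R`, and of the flat deviation; equivalently eventual `δ`-closeness in the same charts for every
`δ > 0`, `ENNReal.tendsto_nhds_zero`) is a final state decomposition with the same data (all other
fields verbatim). Klainerman 2025, §2.3; Klainerman–Szeftel, AMS-210, §1.2 (orbital versus asymptotic
stability). [cite: KlainermanSzeftel2020, §1.2] -/
def toFinalStateDecomposition (q : QuasiFinalStateDecomposition 𝓢 𝒟 k ε)
    (h₁ : ∀ i (R : ℝ),
      Tendsto (fun τ ↦ 𝓢.truncDeviationCk (q.background i) (q.chart i) k R τ) atTop (𝓝 0))
    (h₂ : Tendsto (fun τ ↦ 𝓢.deviationCk (Minkowski.backgroundOn q.flatDomain) q.flatChart k τ)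
      atTop (𝓝 0)) :
    FinalStateDecomposition 𝓢 𝒟 k where
  N := q.N
  mass := q.mass
  spin := q.spin
  mass_pos := q.mass_pos
  abs_spin_le_mass := q.abs_spin_le_mass
  motion := q.motion
  τ₀ := q.τ₀
  chart := q.chart
  isLateChart := q.isLateChart
  tendsto_truncDeviationCk := h₁
  exists_pairwise_disjoint := q.exists_pairwise_disjoint
  excision := q.excision
  tendsto_excision_div := q.tendsto_excision_div
  flatDomain := q.flatDomain
  setOf_lt_excision_subset_flatDomain := q.setOf_lt_excision_subset_flatDomain
  flatChart := q.flatChart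
  isLateChart_flat := q.isLateChart_flat
  tendsto_deviationCk_flat := h₂
  diff_subset_causalPast := q.diff_subset_causalPast

section ToFinal

variable (q : QuasiFinalStateDecomposition 𝓢 𝒟 k ε)
  (h₁ : ∀ i (R : ℝ),
    Tendsto (fun τ ↦ 𝓢.truncDeviationCk (q.background i) (q.chart i) k R τ) atTop (𝓝 0))
  (h₂ : Tendsto (fun τ ↦ 𝓢.deviationCk (Minkowski.backgroundOn q.flatDomain) q.flatChart k τ)
    atTop (𝓝 0))

/-- The converse map keeps the number of holes. [folklore] -/
@[simp]
theorem toFinalStateDecomposition_N : (q.toFinalStateDecomposition h₁ h₂).N = q.N :=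
  rfl

/-- The converse map keeps the masses. [folklore] -/
@[simp]
theorem toFinalStateDecomposition_mass : (q.toFinalStateDecomposition h₁ h₂).mass = q.mass :=
  rfl

/-- The converse map keeps the spins. [folklore] -/
@[simp]
theorem toFinalStateDecomposition_spin : (q.toFinalStateDecomposition h₁ h₂).spin = q.spin :=
  rfl

/-- The converse map keeps the common late time `τ₀`. [folklore] -/
@[simp]
theorem toFinalStateDecomposition_τ₀ : (q.toFinalStateDecomposition h₁ h₂).τ₀ = q.τ₀ :=
  rfl

/-- The converse map keeps the hole backgrounds. [folklore] -/
@[simp]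
theorem toFinalStateDecomposition_background (i : Fin q.N) :
    (q.toFinalStateDecomposition h₁ h₂).background i = q.background i :=
  rfl

/-- The converse map keeps the charted late region. [folklore] -/
@[simp]
theorem toFinalStateDecomposition_charted :
    (q.toFinalStateDecomposition h₁ h₂).charted = q.charted :=
  rfl

/-- Unfolding: the body of `Summit.FinalStateConjecture.certifiedLate (q.toFinalStateDecomposition h₁ h₂)
R τ₁` is `q.certifiedLate R τ₁` (so the two agree by `rfl`). [folklore] -/
theorem toFinalStateDecomposition_certifiedLate (R : Fin q.N → ℝ → ℝ) (τ₁ : ℝ) :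
    (q.toFinalStateDecomposition h₁ h₂).flatChart ''
          (Minkowski.backgroundOn (q.toFinalStateDecomposition h₁ h₂).flatDomain).lateRegion τ₁ ∪
        ⋃ i, (q.toFinalStateDecomposition h₁ h₂).chart i ''
          {x | τ₁ < ((q.toFinalStateDecomposition h₁ h₂).background i).time x.1 ∧
            ((q.toFinalStateDecomposition h₁ h₂).background i).radius x.1 ≤
              R i (((q.toFinalStateDecomposition h₁ h₂).background i).time x.1)} =
      q.certifiedLate R τ₁ :=
  rfl

/-- Unfolding: the body of `Summit.FinalStateConjecture.certifiedSlab (q.toFinalStateDecomposition h₁ h₂)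
R τ₁` is `q.certifiedSlab R τ₁`. [folklore] -/
theorem toFinalStateDecomposition_certifiedSlab (R : Fin q.N → ℝ → ℝ) (τ₁ : ℝ) :
    (q.toFinalStateDecomposition h₁ h₂).flatChart ''
          (Minkowski.backgroundOn (q.toFinalStateDecomposition h₁ h₂).flatDomain).timeSlab τ₁ ∪
        ⋃ i, (q.toFinalStateDecomposition h₁ h₂).chart i ''
          ((q.toFinalStateDecomposition h₁ h₂).background i).truncTimeSlab (R i τ₁) τ₁ =
      q.certifiedSlab R τ₁ :=
  rfl

/-- Round trip: restoring then forgetting convergence is the identity on quasi decompositions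
(same charts; the closeness proofs are irrelevant). [folklore] -/
theorem toQuasi_toFinalStateDecomposition (hε : 0 < ε) :
    (q.toFinalStateDecomposition h₁ h₂).toQuasi hε = q :=
  rfl

end ToFinal

/-- **Asymptotic exhaustiveness of the charts of a quasi decomposition** — verbatim the body of the
Summit-side `HasExhaustiveCharts` of the final state statement, read in the charts of `q`: near-zone radii
`Rᵢ : ℝ → ℝ` with (i) `Cᵏ` CONVERGENCE to boosted Kerr out to `Rᵢ(τ)` and (ii) for every chart time
`τ₁ > τ₀` the covering of `𝒟` outside the certified late region by the causal past of the certified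
slab (a hypothesis clause on given charts, like `HasExhaustiveCharts`; it is the clause that
survives `toFinalStateDecomposition`, see `hasExhaustiveCharts_toFinalStateDecomposition`).
Dafermos–Luk arXiv:1710.01722, §1.2.1 (the exterior region on which closeness to Kerr is asserted).
[folklore] -/
def HasAsymptoticallyExhaustiveCharts (q : QuasiFinalStateDecomposition 𝓢 𝒟 k ε) : Prop :=
  ∃ R : Fin q.N → ℝ → ℝ,
    (∀ i, Tendsto (fun τ ↦ 𝓢.truncDeviationCk (q.background i) (q.chart i) k (R i τ) τ)
      atTop (𝓝 0)) ∧
    ∀ τ₁ : ℝ, q.τ₀ < τ₁ →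
      𝒟 \ q.certifiedLate R τ₁ ⊆ 𝓢.metric.causalPast 𝓢.timeOrientation (q.certifiedSlab R τ₁)

/-- The `∀ δ > 0` form of asymptotic exhaustiveness: growing radii with EVENTUAL `δ`-closeness out to
`Rᵢ(τ)` for every `δ > 0` (in the same charts, with the same radii) plus the covering clause give
`HasAsymptoticallyExhaustiveCharts` (`ENNReal.tendsto_nhds_zero`). [folklore] -/
theorem hasAsymptoticallyExhaustiveCharts_of_forall (q : QuasiFinalStateDecomposition 𝓢 𝒟 k ε)
    (h : ∃ R : Fin q.N → ℝ → ℝ,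
      (∀ δ : ℝ≥0∞, 0 < δ → ∀ i, ∀ᶠ τ in atTop,
        𝓢.truncDeviationCk (q.background i) (q.chart i) k (R i τ) τ ≤ δ) ∧
      ∀ τ₁ : ℝ, q.τ₀ < τ₁ →
        𝒟 \ q.certifiedLate R τ₁ ⊆
          𝓢.metric.causalPast 𝓢.timeOrientation (q.certifiedSlab R τ₁)) :
    q.HasAsymptoticallyExhaustiveCharts := by
  obtain ⟨R, hR, hcov⟩ := h
  exact ⟨R, fun i ↦ ENNReal.tendsto_nhds_zero.2 fun δ hδ ↦ hR δ hδ i, hcov⟩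

/-- Asymptotic exhaustiveness implies `ε`-quasi exhaustiveness for `ε > 0` (same radii;
`Filter.Tendsto.eventually` with `ge_mem_nhds`). [folklore] -/
theorem HasAsymptoticallyExhaustiveCharts.hasExhaustiveCharts {q : QuasiFinalStateDecomposition 𝓢 𝒟 k ε}
    (h : q.HasAsymptoticallyExhaustiveCharts) (hε : 0 < ε) : q.HasExhaustiveCharts := by
  obtain ⟨R, hR, hcov⟩ := h
  exact ⟨R, fun i ↦ (hR i).eventually (ge_mem_nhds hε), hcov⟩

/-- **Summit-side exhaustiveness of the converse map**: asymptotic exhaustiveness of the charts of `q`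
is, verbatim, the body of `Summit.FinalStateConjecture.HasExhaustiveCharts
(q.toFinalStateDecomposition h₁ h₂)` (same radii; the certified regions agree by `rfl`,
`toFinalStateDecomposition_certifiedLate/Slab`). [folklore] -/
theorem hasExhaustiveCharts_toFinalStateDecomposition (q : QuasiFinalStateDecomposition 𝓢 𝒟 k ε)
    (h₁ : ∀ i (R : ℝ),
      Tendsto (fun τ ↦ 𝓢.truncDeviationCk (q.background i) (q.chart i) k R τ) atTop (𝓝 0))
    (h₂ : Tendsto (fun τ ↦ 𝓢.deviationCk (Minkowski.backgroundOn q.flatDomain) q.flatChart k τ)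
      atTop (𝓝 0))
    (h : q.HasAsymptoticallyExhaustiveCharts) :
    ∃ R : Fin (q.toFinalStateDecomposition h₁ h₂).N → ℝ → ℝ,
      (∀ i, Tendsto (fun τ ↦ 𝓢.truncDeviationCk ((q.toFinalStateDecomposition h₁ h₂).background i)
        ((q.toFinalStateDecomposition h₁ h₂).chart i) k (R i τ) τ) atTop (𝓝 0)) ∧
      ∀ τ₁ : ℝ, (q.toFinalStateDecomposition h₁ h₂).τ₀ < τ₁ →
        𝒟 \ ((q.toFinalStateDecomposition h₁ h₂).flatChart ''
              (Minkowski.backgroundOn (q.toFinalStateDecomposition h₁ h₂).flatDomain).lateRegion τ₁ ∪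
            ⋃ i, (q.toFinalStateDecomposition h₁ h₂).chart i ''
              {x | τ₁ < ((q.toFinalStateDecomposition h₁ h₂).background i).time x.1 ∧
                ((q.toFinalStateDecomposition h₁ h₂).background i).radius x.1 ≤
                  R i (((q.toFinalStateDecomposition h₁ h₂).background i).time x.1)}) ⊆
          𝓢.metric.causalPast 𝓢.timeOrientation
            ((q.toFinalStateDecomposition h₁ h₂).flatChart ''
                (Minkowski.backgroundOn (q.toFinalStateDecomposition h₁ h₂).flatDomain).timeSlab τ₁ ∪
              ⋃ i, (q.toFinalStateDecomposition h₁ h₂).chart i ''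
                ((q.toFinalStateDecomposition h₁ h₂).background i).truncTimeSlab (R i τ₁) τ₁) :=
  h

end QuasiFinalStateDecomposition

namespace FinalStateDecomposition

variable {𝓢 : Spacetime.{u} 4} {𝒟 : Set 𝓢.carrier} {k : ℕ} {ε : ℝ≥0∞}

/-- Round trip: forgetting then restoring convergence is the identity on final state decompositions
(structure eta). [folklore] -/
theorem toFinalStateDecomposition_toQuasi (d : FinalStateDecomposition 𝓢 𝒟 k) (hε : 0 < ε) :
    (d.toQuasi hε).toFinalStateDecomposition d.tendsto_truncDeviationCk d.tendsto_deviationCk_flat =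
      d :=
  rfl

/-- Unfolding: asymptotic exhaustiveness of `d.toQuasi hε` is, verbatim, the body of
`Summit.FinalStateConjecture.HasExhaustiveCharts d`. [folklore] -/
theorem hasAsymptoticallyExhaustiveCharts_toQuasi_iff (d : FinalStateDecomposition 𝓢 𝒟 k)
    (hε : 0 < ε) :
    (d.toQuasi hε).HasAsymptoticallyExhaustiveCharts ↔
      ∃ R : Fin d.N → ℝ → ℝ,
        (∀ i, Tendsto (fun τ ↦ 𝓢.truncDeviationCk (d.background i) (d.chart i) k (R i τ) τ)
          atTop (𝓝 0)) ∧
        ∀ τ₁ : ℝ, d.τ₀ < τ₁ →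
          𝒟 \ (d.flatChart '' (Minkowski.backgroundOn d.flatDomain).lateRegion τ₁ ∪
              ⋃ i, d.chart i '' {x | τ₁ < (d.background i).time x.1 ∧
                (d.background i).radius x.1 ≤ R i ((d.background i).time x.1)}) ⊆
            𝓢.metric.causalPast 𝓢.timeOrientation
              (d.flatChart '' (Minkowski.backgroundOn d.flatDomain).timeSlab τ₁ ∪
                ⋃ i, d.chart i '' (d.background i).truncTimeSlab (R i τ₁) τ₁) :=
  Iff.rfl

end FinalStateDecomposition

end Literature.Geometry.Lorentzian

end
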